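import Summits.BirchSwinnertonDyer.BirchSwinnertonDyer.Theorems.PrintX8SharpFlatMuDefect
import Summits.BirchSwinnertonDyer.BirchSwinnertonDyer.Theorems.SignedLowerHalvesSprungLowerDivisibilityAtThreeCharIdealLowerGlue
import HarnessLib

/-!
# Crux K1 `SprungLowerDivisibilityAtThree` (stmt-BirchSwinnertonDyer-19875), line `chromatic-common-zeros`:
# groundwork for stub S4 `stub_cyclotomicLower` — the local Eisenstein inequality is COLOUR-FREE
# (`--supports` 19875 as helper; closes nothing by itself)

Prime by prime over `Λ = ℤ_p⟦T⟧`, for ONE pinned Kato module `I = 𝐇¹_Γ(T_pW)` carrying the ♯/♭ Coleman–Kato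
packages `C^•` of Sprung 2012 Thm. 7.14 (3) (tree structure `Sprung2012.SharpFlatColemanKatoData`, four-term
identity `SharpFlatColemanKatoData.lengthAt_add_eq` = Prop. 7.19:
`ℓ_𝔭 X^• + ℓ_𝔭(𝐇¹/Z^•) = ℓ_𝔭 X₀ + ℓ_𝔭 Λ/(G^•)`):

* `SharpFlatColemanKatoData.lengthAt_quotient_zeta_ne_top` — `ℓ_𝔭(𝐇¹/Z^•) < ∞` at every height-one `𝔭`
  (when `L^• ≠ 0`, `G^• ≠ 0`): `𝐇¹/Z ↪ Λ/Col^•(Z)` and `Λ/(s·G^•) ↠ Λ/Col^•(Z)` (Def. 6.1 read on ideals).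
* `SharpFlatColemanKatoData.eisenstein_iff_fine` — for a finitely generated torsion dual datum `D` of
  `Sel^•(E/ℚ_∞)` and any dual datum `Y` of the fine Selmer group:
  `ℓ_𝔭 Λ/(G^•) ≤ ℓ_𝔭 X^•  ⟺  ℓ_𝔭(𝐇¹/Z^•) ≤ ℓ_𝔭 X₀`.
  The right side does not mention the colour: the local Eisenstein inequality of Sprung's ♯/♭ main
  conjecture at `𝔭` IS Kato's fine inequality («`Z(T)` is not more divisible than `X₀` allows») at `𝔭`.
* `SharpFlatColemanKatoData.colour_transfer` — for the JOINT package (`C.Z = C'.Z`, the binder shape of the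
  reshaped stubs S1/S4): the inequality at `𝔭` for colour `•` ⟺ for colour `∘`. Hence stub S4 (the inequality at
  the cyclotomic common zeros) need only be proved for ONE colour — e.g. the colour of THEOREM B (`μ = 0`) or the
  colour with the simple zero at `T` (Kobayashi 2013 at `r_an = 1`) — the Λ-adic, every-prime form of the
  `T`-adic identity `colour_transfer_at_T` of the merged card `chromatic-gcd-squeeze`.
* `ENat.le_iff_le_of_add_eq_add` — the bookkeeping in `ℕ∞`.

Pure module theory over the package; no arithmetic input, no named fact. K1, Sprung's main conjecture and BSD on
leaf X8 are NOT proved by this file.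

References: [Sprung2012] Def. 6.1 (p. 1495), Thm. 7.14 (3) (p. 1504), Prop. 7.19 (p. 1505); [Kato2004Asterisque]
Conj. 12.10 (p. 224), Thm. 12.5/12.6 (p. 222), §17.13 (p. 280); [KuriharaPollack2007] §1; [Washington1997] §13.2.
-/

set_option autoImplicit false
-- justification: the mandated namespace `Summit.BirchSwinnertonDyer.BirchSwinnertonDyer.Theorems`
-- (single-conjunct summit, Sub = Summit) repeats a segment by design (D-0017).
set_option linter.dupNamespace false

noncomputable section

open scoped Classical NumberField MatrixGroups ModularForm

open NumberField IsDedekindDomain CongruenceSubgroup WeierstrassCurve Field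
  Literature.NumberTheory.EllipticCurves Literature.NumberTheory.EllipticCurves.ModularForms
  Literature.NumberTheory.EllipticCurves.ZpExtension Literature.NumberTheory.EllipticCurves.Sprung2017
  Literature.NumberTheory.EllipticCurves.Sprung2012 Literature.NumberTheory.EllipticCurves.Kato2004
  Literature.NumberTheory.EllipticCurves.Module
  Summit.BirchSwinnertonDyer.BirchSwinnertonDyer.Theorems
  Summit.BirchSwinnertonDyer.BirchSwinnertonDyer.Theorems.SmallImageSignedMuDefect

namespace Summit.BirchSwinnertonDyer.BirchSwinnertonDyer.Theorems.ChromaticCommonZeros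

/-! ### Bookkeeping in `ℕ∞` -/

/-- From `a + b = c + d` in `ℕ∞` with `a, b, d` finite: `d ≤ a ↔ b ≤ c`. [folklore] -/
theorem ENat.le_iff_le_of_add_eq_add {a b c d : ℕ∞} (h : a + b = c + d) (ha : a ≠ ⊤) (hb : b ≠ ⊤)
    (hd : d ≠ ⊤) : d ≤ a ↔ b ≤ c := by
  lift a to ℕ using ha
  lift b to ℕ using hb
  lift d to ℕ using hd
  have hc : c ≠ ⊤ := by
    intro hc
    rw [hc, top_add] at h
    exact ENat.coe_ne_top (a + b) (by exact_mod_cast h)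
  lift c to ℕ using hc
  have h' : a + b = c + d := by exact_mod_cast h
  constructor
  · intro hda
    exact_mod_cast (show b ≤ c by have := (ENat.coe_le_coe.mp hda); omega)
  · intro hbc
    exact_mod_cast (show d ≤ a by have := (ENat.coe_le_coe.mp hbc); omega)

/-! ### The package: finiteness of `ℓ_𝔭(𝐇¹/Z)` and the colour-free form of the Eisenstein inequality -/

section Package

variable (W : WeierstrassCurve ℚ) [W.IsElliptic] (p : ℕ) [Fact p.Prime]
  [ContinuousSMul ℤ_[p] (W.tateModule p)] [Module.Free ℤ_[p] (W.tateModule p)]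
  [Module.Finite ℤ_[p] (W.tateModule p)]
  {N : ℕ} {f : CuspForm (Gamma0 N) 2} {ϖ : ℚ} {κ : ZpExtension ℚ p} {γ : absoluteGaloisGroup ℚ}
  {E : Type} [Field E] [Algebra ℚ E] {ι : AlgebraicClosure ℚ →ₐ[ℚ] AlgebraicClosure E} {ap : ℤ}
  {g : absoluteGaloisGroup E} {c : ℕ → localPoints W E}
  {I : IwasawaH1Data W p κ γ}

/-- **`ℓ_𝔭(𝐇¹/Z) < ∞` at every height-one prime.** For a ♯/♭ Coleman–Kato package `C` of colour `•` with
`L^• ≠ 0` (so `Col^•` is injective) and a Néron-normalised `G₁ ≠ 0`: `𝐇¹/Z ↪ Λ/Col^•(Z)`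
(`lengthAt_quotient_map_eq_add`) and `(s·G₁) ⊆ Col^•(Z)` with `s·G₁ ≠ 0` (`image_zeta_localized`), so the
local length of `𝐇¹/Z` is bounded by that of the cyclic torsion module `Λ/(s·G₁)`.
[cite: Sprung2012, Def. 6.1 (p. 1495), Thm. 7.14 (3) (p. 1504)] [cite: Kato2004Asterisque, Thm. 12.5 (p. 222)] -/
theorem _root_.Literature.NumberTheory.EllipticCurves.Sprung2012.SharpFlatColemanKatoData.lengthAt_quotient_zeta_ne_top
    {col : Chroma} (C : SharpFlatColemanKatoData W p f ϖ κ γ ι ap g c col I)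
    (hirr : W.HasIrreducibleModPGaloisRep p) {Lsharp Lflat G₁ : IwasawaAlgebra p}
    (hSP : IsSprungPair f p ap Lsharp Lflat) (hcol : chromaticL col Lsharp Lflat ≠ 0)
    (hG₁ : iwasawaToPowerSeries p G₁ =
      PowerSeries.C ((ϖ : ℚ) : ℚ_[p]) * iwasawaToPowerSeries p (chromaticL col Lsharp Lflat))
    (hG0 : G₁ ≠ 0) (𝔭 : PrimeSpectrum (IwasawaAlgebra p)) (h𝔭 : 𝔭.asIdeal.height = 1) :
    Module.lengthAt (IwasawaAlgebra p) (I.H ⧸ C.Z) 𝔭 ≠ ⊤ := by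
  obtain ⟨s, hs, hsG, -⟩ := C.image_zeta_localized hirr Lsharp Lflat G₁ hSP hG₁ 𝔭 h𝔭
  have hs0 : s ≠ 0 := fun h0 => hs (h0 ▸ 𝔭.asIdeal.zero_mem)
  have hsG0 : s * G₁ ≠ 0 := mul_ne_zero hs0 hG0
  -- `𝐇¹/Z ↪ Λ/Col(Z)`
  have h1 : Module.lengthAt (IwasawaAlgebra p) (I.H ⧸ C.Z) 𝔭 ≤
      Module.lengthAt (IwasawaAlgebra p) (IwasawaAlgebra p ⧸ Submodule.map C.colMap C.Z) 𝔭 := by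
    rw [lengthAt_quotient_map_eq_add C.colMap (C.colMap_injective Lsharp Lflat hSP hcol) C.Z 𝔭]
    exact le_self_add
  -- `Λ/(s G₁) ↠ Λ/Col(Z)`
  have hle : (Ideal.span {s * G₁} : Ideal (IwasawaAlgebra p)) ≤ Submodule.map C.colMap C.Z := by
    rw [Ideal.span_singleton_le_iff_mem]
    exact hsG
  have h2 : Module.lengthAt (IwasawaAlgebra p) (IwasawaAlgebra p ⧸ Submodule.map C.colMap C.Z) 𝔭 ≤
      Module.lengthAt (IwasawaAlgebra p) (IwasawaAlgebra p ⧸ Ideal.span {s * G₁}) 𝔭 :=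
    lengthAt_le_of_surjective (Submodule.factor hle) (Submodule.factor_surjective hle) 𝔭
  -- `Λ/(s G₁)` has finite local length at the height-one prime `𝔭`
  have h3 : Module.lengthAt (IwasawaAlgebra p) (IwasawaAlgebra p ⧸ Ideal.span {s * G₁}) 𝔭 ≠ ⊤ :=
    lengthAt_ne_top_of_isTorsionBy hsG0 (isTorsionBy_quotient_span_singleton (s * G₁)) 𝔭 (le_of_eq h𝔭)
  exact ne_top_of_le_ne_top h3 (h1.trans h2)

/-- **The local Eisenstein inequality is Kato's fine inequality (colour-free form).** For a ♯/♭ package `C`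
of colour `•` (`L^• ≠ 0`, `E[p]` irreducible, Néron-normalised `G₁ ≠ 0`), a finitely generated torsion dual
datum `D` of `Sel^•(E/ℚ_∞)`, any dual datum `Y` of `Sel₀(ℚ_∞, E[p^∞])` and a height-one prime `𝔭`:
`ℓ_𝔭 Λ/(G₁) ≤ ℓ_𝔭 X^•  ⟺  ℓ_𝔭(𝐇¹/Z) ≤ ℓ_𝔭 X₀` — by the four-term identity
`ℓ_𝔭 X^• + ℓ_𝔭(𝐇¹/Z) = ℓ_𝔭 X₀ + ℓ_𝔭 Λ/(G₁)` (Sprung Prop. 7.19 ∕ Kato §17.13) with all but possibly `ℓ_𝔭 X₀`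
finite. The right side is the colour-free content of stub S4. [cite: Sprung2012, Prop. 7.19 (p. 1505)]
[cite: Kato2004Asterisque, Conj. 12.10 (p. 224) and §17.13 (p. 280)] -/
theorem _root_.Literature.NumberTheory.EllipticCurves.Sprung2012.SharpFlatColemanKatoData.eisenstein_iff_fine
    {col : Chroma} (C : SharpFlatColemanKatoData W p f ϖ κ γ ι ap g c col I)
    (hirr : W.HasIrreducibleModPGaloisRep p) {Lsharp Lflat G₁ : IwasawaAlgebra p}
    (hSP : IsSprungPair f p ap Lsharp Lflat) (hcol : chromaticL col Lsharp Lflat ≠ 0)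
    (hG₁ : iwasawaToPowerSeries p G₁ =
      PowerSeries.C ((ϖ : ℚ) : ℚ_[p]) * iwasawaToPowerSeries p (chromaticL col Lsharp Lflat))
    (hG0 : G₁ ≠ 0) (D : SharpFlatSelmerDualData W κ γ ι ap g c col)
    [Module.Finite (IwasawaAlgebra p) D.X] (hXt : Module.IsTorsion (IwasawaAlgebra p) D.X)
    (Y : W.FineSelmerDualData κ γ) (𝔭 : PrimeSpectrum (IwasawaAlgebra p)) (h𝔭 : 𝔭.asIdeal.height = 1) :
    Module.lengthAt (IwasawaAlgebra p) (IwasawaAlgebra p ⧸ Ideal.span {G₁}) 𝔭 ≤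
        Module.lengthAt (IwasawaAlgebra p) D.X 𝔭 ↔
      Module.lengthAt (IwasawaAlgebra p) (I.H ⧸ C.Z) 𝔭 ≤ Module.lengthAt (IwasawaAlgebra p) Y.X 𝔭 := by
  have h4 := C.lengthAt_add_eq W p hirr hSP hcol hG₁ D Y 𝔭 h𝔭
  -- finiteness of `ℓ_𝔭 X^•` (f.g. torsion), `ℓ_𝔭(𝐇¹/Z)` and `ℓ_𝔭 Λ/(G₁)`
  obtain ⟨t, htann, ht0⟩ := Submodule.annihilator_top_inter_nonZeroDivisors hXt
  have ht : t ≠ 0 := nonZeroDivisors.ne_zero ht0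
  have htX : Module.IsTorsionBy (IwasawaAlgebra p) D.X t := fun x =>
    Submodule.mem_annihilator.mp htann x Submodule.mem_top
  have ha : Module.lengthAt (IwasawaAlgebra p) D.X 𝔭 ≠ ⊤ :=
    lengthAt_ne_top_of_isTorsionBy ht htX 𝔭 (le_of_eq h𝔭)
  have hb : Module.lengthAt (IwasawaAlgebra p) (I.H ⧸ C.Z) 𝔭 ≠ ⊤ :=
    C.lengthAt_quotient_zeta_ne_top W p hirr hSP hcol hG₁ hG0 𝔭 h𝔭
  have hd : Module.lengthAt (IwasawaAlgebra p) (IwasawaAlgebra p ⧸ Ideal.span {G₁}) 𝔭 ≠ ⊤ :=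
    lengthAt_ne_top_of_isTorsionBy hG0 (isTorsionBy_quotient_span_singleton G₁) 𝔭 (le_of_eq h𝔭)
  exact ENat.le_iff_le_of_add_eq_add h4 ha hb hd

/-- **COLOUR TRANSFER, prime by prime.** For the JOINT ♯/♭ Coleman–Kato package — two colours `•`, `∘` on
one pinned `I = 𝐇¹_Γ(T_pW)` with the SAME zeta submodule (`C.Z = C'.Z`; Kato's `Z(T) = Λ·z_Kato` is colour-blind),
both `L^• ≠ 0`, `L^∘ ≠ 0`, Néron-normalised `G, G' ≠ 0` — and finitely generated torsion dual data `D`, `D'`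
of `Sel^•`, `Sel^∘`, at every height-one prime `𝔭`:
`ℓ_𝔭 Λ/(G) ≤ ℓ_𝔭 X^•  ⟺  ℓ_𝔭 Λ/(G') ≤ ℓ_𝔭 X^∘` (both are `ℓ_𝔭(𝐇¹/Z) ≤ ℓ_𝔭 X₀`). So the local Eisenstein
inequality of Sprung's main conjecture — in particular stub S4 at the cyclotomic common zeros — holds for one
colour iff for the other. [cite: Sprung2012, Thm. 7.14 (3) (p. 1504), Prop. 7.19 (p. 1505)]
[cite: Kato2004Asterisque, Thm. 12.6 (p. 222), §17.13 (p. 280)] -/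
theorem _root_.Literature.NumberTheory.EllipticCurves.Sprung2012.SharpFlatColemanKatoData.colour_transfer
    {col col' : Chroma} (C : SharpFlatColemanKatoData W p f ϖ κ γ ι ap g c col I)
    (C' : SharpFlatColemanKatoData W p f ϖ κ γ ι ap g c col' I) (hZ : C.Z = C'.Z)
    (hirr : W.HasIrreducibleModPGaloisRep p) {Lsharp Lflat G G' : IwasawaAlgebra p}
    (hSP : IsSprungPair f p ap Lsharp Lflat) (hcol : chromaticL col Lsharp Lflat ≠ 0)
    (hcol' : chromaticL col' Lsharp Lflat ≠ 0)
    (hG : iwasawaToPowerSeries p G =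
      PowerSeries.C ((ϖ : ℚ) : ℚ_[p]) * iwasawaToPowerSeries p (chromaticL col Lsharp Lflat))
    (hG' : iwasawaToPowerSeries p G' =
      PowerSeries.C ((ϖ : ℚ) : ℚ_[p]) * iwasawaToPowerSeries p (chromaticL col' Lsharp Lflat))
    (hG0 : G ≠ 0) (hG'0 : G' ≠ 0)
    (D : SharpFlatSelmerDualData W κ γ ι ap g c col) [Module.Finite (IwasawaAlgebra p) D.X]
    (hXt : Module.IsTorsion (IwasawaAlgebra p) D.X)
    (D' : SharpFlatSelmerDualData W κ γ ι ap g c col') [Module.Finite (IwasawaAlgebra p) D'.X]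
    (hXt' : Module.IsTorsion (IwasawaAlgebra p) D'.X)
    (Y : W.FineSelmerDualData κ γ) (𝔭 : PrimeSpectrum (IwasawaAlgebra p)) (h𝔭 : 𝔭.asIdeal.height = 1) :
    Module.lengthAt (IwasawaAlgebra p) (IwasawaAlgebra p ⧸ Ideal.span {G}) 𝔭 ≤
        Module.lengthAt (IwasawaAlgebra p) D.X 𝔭 ↔
      Module.lengthAt (IwasawaAlgebra p) (IwasawaAlgebra p ⧸ Ideal.span {G'}) 𝔭 ≤
        Module.lengthAt (IwasawaAlgebra p) D'.X 𝔭 := by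
  rw [C.eisenstein_iff_fine W p hirr hSP hcol hG hG0 D hXt Y 𝔭 h𝔭,
    C'.eisenstein_iff_fine W p hirr hSP hcol' hG' hG'0 D' hXt' Y 𝔭 h𝔭, hZ]

end Package

end Summit.BirchSwinnertonDyer.BirchSwinnertonDyer.Theorems.ChromaticCommonZeros

end
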